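import Mathlib
import Literature.MathematicalPhysics.StatisticalMechanics.BarlowCoordination
import HarnessLib

/-!
# Every orientation of a close-packed stacking has three steep transport families

HONEST FRAMING. Part of the venture `Summits/Ventures/Crystal3D` (cell `crystal3d-full`), helper
`--supports` the crux `NoReconstructionGain` (stmt-Ventures-19144, route
`route-Ventures-StickyWulffConstant`), line `adhesion`, GRAIN RUNG.  Elementary real inequalities
only.

A Barlow stacking (in-layer spacing `1`, layer spacing `h = √(2/3)`) seen from a unit direction
`ν' = (x, y, z)` (the substrate normal pulled back into the stacking frame) has six transport
families: the three in-layer translations, with slopes (height gained per step)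
`x`, `x/2 + (√3/2) y`, `x/2 − (√3/2) y`, and the interlayer chain steps, whose slope at a layer
with Hägg letter `s = ±1` and adjacent-layer offset `(P, Q) ∈ threeOffsets (−s)` is
`−P x − Q (x/2 + (√3/2) y) + s (x/2 + (√3/6) y) + h z`.
`orientation_cases`: for every unit `(x, y, z)` one of four things happens —
(I) every chain step (both letters, all three offsets) has slope `> 19/100`;
(IV) every chain step has slope `< −19/100`;
(II) two of the three in-layer slopes have absolute value `> 19/100` and for each letter some
offset has slope `> 19/100`; (III) the same with `< −19/100`.
In every case three slot-disjoint families are steeper than the toucher band `1 − h < 19/100`,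
which is what the grain rung consumes (the minimum credit `3` is attained, e.g. at `ν' = e₃`).

WHAT THIS IS NOT: anything about packings; rung F-C1 not moved.
-/

noncomputable section

namespace Summit.Ventures.Crystal3D.Theorems

open Real
open Literature.MathematicalPhysics.StatisticalMechanics (threeOffsets)

/-- The three adjacent-layer offsets for letter `s = ±1`, as explicit alternatives. -/
theorem threeOffsets_neg_cases {s : ℤ} (hs : s = 1 ∨ s = -1) {PQ : ℤ × ℤ}
    (h : PQ ∈ threeOffsets (-s)) : PQ = (0, 0) ∨ PQ = (s, 0) ∨ PQ = (0, s) := by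
  obtain ⟨P, Q⟩ := PQ
  rcases hs with rfl | rfl
  · simpa [threeOffsets] using h
  · simpa [threeOffsets] using h

/-- `(0, 0)`, `(s, 0)`, `(0, s)` belong to `threeOffsets (−s)` (`s = ±1`). -/
theorem mem_threeOffsets_neg_of {s : ℤ} (hs : s = 1 ∨ s = -1) :
    ((0 : ℤ), (0 : ℤ)) ∈ threeOffsets (-s) ∧ (s, (0 : ℤ)) ∈ threeOffsets (-s) ∧
      ((0 : ℤ), s) ∈ threeOffsets (-s) := by
  rcases hs with rfl | rfl
  · simp [threeOffsets]
  · simp [threeOffsets]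

/-- Bounds on `h = √(2/3)`: `81/100 < h < 82/100`. -/
theorem sqrt_two_thirds_bounds' :
    (81 : ℝ) / 100 < Real.sqrt (2 / 3) ∧ Real.sqrt (2 / 3) < 82 / 100 := by
  have h0 : 0 ≤ Real.sqrt (2 / 3) := Real.sqrt_nonneg _
  have h2 : Real.sqrt (2 / 3) ^ 2 = 2 / 3 := Real.sq_sqrt (by norm_num)
  constructor <;> nlinarith [h2, h0]

set_option maxHeartbeats 400000 in
/-- **Case I engine.**  If `z ≥ 3/4` then every chain slope exceeds `19/100`. -/
theorem chainSlope_gt_of_z_ge (x y z : ℝ) (hxyz : x ^ 2 + y ^ 2 + z ^ 2 = 1) (hz : 3 / 4 ≤ z)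
    {s : ℤ} (hs : s = 1 ∨ s = -1) {PQ : ℤ × ℤ} (hPQ : PQ ∈ threeOffsets (-s)) :
    19 / 100 < -(PQ.1 : ℝ) * x - (PQ.2 : ℝ) * (x / 2 + Real.sqrt 3 / 2 * y) +
      (s : ℝ) * (x / 2 + Real.sqrt 3 / 6 * y) + Real.sqrt (2 / 3) * z := by
  obtain ⟨hlo, hhi⟩ := sqrt_two_thirds_bounds'
  have h3 : Real.sqrt 3 ^ 2 = 3 := Real.sq_sqrt (by norm_num)
  have hxy : x ^ 2 + y ^ 2 ≤ 7 / 16 := by nlinarith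
  have hhz : 243 / 400 ≤ Real.sqrt (2 / 3) * z := by nlinarith
  -- the horizontal part `H` has `H² ≤ (x²+y²)/3 ≤ 7/48 < 4/25`
  have key : ∀ H : ℝ, H ^ 2 ≤ (x ^ 2 + y ^ 2) / 3 →
      19 / 100 < H + Real.sqrt (2 / 3) * z := by
    intro H hH
    have : -(2 / 5) ≤ H := by nlinarith
    linarith
  rcases threeOffsets_neg_cases hs hPQ with rfl | rfl | rfl <;> rcases hs with rfl | rfl <;>
    push_cast <;>
    first
    | (have e := key (x / 2 + Real.sqrt 3 / 6 * y) (by nlinarith [sq_nonneg (x / 2 - Real.sqrt 3 / 2 * y)]);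
        linarith)
    | (have e := key (-(x / 2 + Real.sqrt 3 / 6 * y)) (by nlinarith [sq_nonneg (x / 2 - Real.sqrt 3 / 2 * y)]);
        linarith)
    | (have e := key (-x / 2 + Real.sqrt 3 / 6 * y) (by nlinarith [sq_nonneg (x / 2 + Real.sqrt 3 / 2 * y)]);
        linarith)
    | (have e := key (-(-x / 2 + Real.sqrt 3 / 6 * y)) (by nlinarith [sq_nonneg (x / 2 + Real.sqrt 3 / 2 * y)]);
        linarith)
    | (have e := key (-(Real.sqrt 3 / 3 * y)) (by nlinarith [sq_nonneg x]); linarith)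
    | (have e := key (Real.sqrt 3 / 3 * y) (by nlinarith [sq_nonneg x]); linarith)

/-- Three reals with zero sum, each at most `M`, have sum of squares `≤ 6 M²`. -/
theorem sum_sq_le_six_mul_sq (u v w M : ℝ) (hsum : u + v + w = 0) (hu : u ≤ M) (hv : v ≤ M)
    (hw : w ≤ M) : u ^ 2 + v ^ 2 + w ^ 2 ≤ 6 * M ^ 2 := by
  have hw' : w = -u - v := by linarith
  subst hw'
  have hpos : 0 ≤ u + v + M := by linarith
  nlinarith [mul_nonneg (sub_nonneg.2 hu) (sub_nonneg.2 hv), mul_nonneg (sub_nonneg.2 hu) hpos,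
    mul_nonneg (sub_nonneg.2 hv) hpos]

/-- **Case II engine.**  If `z ≥ −1/20` then for each letter `s = ±1` some adjacent-layer offset
has chain slope `> 19/100`. -/
theorem exists_chainSlope_gt_of_z_ge (x y z : ℝ) (hxyz : x ^ 2 + y ^ 2 + z ^ 2 = 1)
    (hz : -(1 / 20) ≤ z) {s : ℤ} (hs : s = 1 ∨ s = -1) :
    ∃ PQ ∈ threeOffsets (-s), 19 / 100 < -(PQ.1 : ℝ) * x - (PQ.2 : ℝ) * (x / 2 + Real.sqrt 3 / 2 * y) +
      (s : ℝ) * (x / 2 + Real.sqrt 3 / 6 * y) + Real.sqrt (2 / 3) * z := by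
  obtain ⟨hlo, hhi⟩ := sqrt_two_thirds_bounds'
  have h3 : Real.sqrt 3 ^ 2 = 3 := Real.sq_sqrt (by norm_num)
  obtain ⟨h00, hs0, h0s⟩ := mem_threeOffsets_neg_of hs
  have hs2 : (s : ℝ) ^ 2 = 1 := by rcases hs with rfl | rfl <;> norm_num
  -- the three horizontal parts for letter `s`; they sum to zero and have second moment `(x²+y²)/2`
  set H₁ : ℝ := (s : ℝ) * (x / 2 + Real.sqrt 3 / 6 * y) with hH₁
  set H₂ : ℝ := (s : ℝ) * (x / 2 + Real.sqrt 3 / 6 * y) - (s : ℝ) * x with hH₂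
  set H₃ : ℝ := (s : ℝ) * (x / 2 + Real.sqrt 3 / 6 * y) - (s : ℝ) * (x / 2 + Real.sqrt 3 / 2 * y)
    with hH₃
  have hsum : H₁ + H₂ + H₃ = 0 := by
    simp only [hH₁, hH₂, hH₃]; ring
  have hsq : H₁ ^ 2 + H₂ ^ 2 + H₃ ^ 2 = (x ^ 2 + y ^ 2) / 2 := by
    simp only [hH₁, hH₂, hH₃]
    linear_combination ((x / 2 + Real.sqrt 3 / 6 * y) ^ 2 +
      (x / 2 + Real.sqrt 3 / 6 * y - x) ^ 2 +
      (x / 2 + Real.sqrt 3 / 6 * y - (x / 2 + Real.sqrt 3 / 2 * y)) ^ 2) * hs2 + (y ^ 2 / 6) * h3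
  -- it suffices that some `H_i > M := 19/100 − h z`
  set M : ℝ := 19 / 100 - Real.sqrt (2 / 3) * z with hMdef
  have hkey : M < H₁ ∨ M < H₂ ∨ M < H₃ := by
    by_contra hcon
    push Not at hcon
    obtain ⟨h1, h2, h3'⟩ := hcon
    have h0 : 0 ≤ Real.sqrt (2 / 3) := Real.sqrt_nonneg _
    by_cases hz3 : 3 / 10 ≤ z
    · -- then `M < 0`, contradicting the zero sum
      have e1 : Real.sqrt (2 / 3) * (3 / 10) ≤ Real.sqrt (2 / 3) * z :=
        mul_le_mul_of_nonneg_left hz3 h0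
      have : M < 0 := by rw [hMdef]; linarith
      linarith
    · have hz3 := not_le.1 hz3
      have hz2 : z ^ 2 < 9 / 100 := by
        nlinarith [mul_pos (show (0:ℝ) < 3 / 10 - z by linarith) (show (0:ℝ) < z + 3 / 10 by linarith)]
      have hxy : 91 / 100 < x ^ 2 + y ^ 2 := by linarith
      have h6 := sum_sq_le_six_mul_sq H₁ H₂ H₃ M hsum h1 h2 h3'
      have e1 : Real.sqrt (2 / 3) * (-z) ≤ Real.sqrt (2 / 3) * (1 / 20) :=
        mul_le_mul_of_nonneg_left (by linarith) h0
      have e2 : Real.sqrt (2 / 3) * z ≤ Real.sqrt (2 / 3) * (3 / 10) :=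
        mul_le_mul_of_nonneg_left hz3.le h0
      have hM1 : M ≤ 231 / 1000 := by rw [hMdef]; linarith
      have hM2 : -(231 / 1000) ≤ M := by rw [hMdef]; linarith
      have hM3 : M ^ 2 ≤ (231 / 1000) ^ 2 := by
        nlinarith [mul_nonneg (sub_nonneg.2 hM1) (show (0:ℝ) ≤ M + 231 / 1000 by linarith)]
      linarith
  rcases hkey with hk | hk | hk
  · refine ⟨(0, 0), h00, ?_⟩
    push_cast
    rw [hMdef, hH₁] at hk; linarith
  · refine ⟨(s, 0), hs0, ?_⟩
    push_cast
    rw [hMdef, hH₂] at hk; linarith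
  · refine ⟨(0, s), h0s, ?_⟩
    push_cast
    rw [hMdef, hH₃] at hk; linarith

/-- **Two steep in-layer families.**  If `z² ≤ 9/16` then at least two of the three in-layer
slopes `x`, `x/2 + (√3/2) y`, `x/2 − (√3/2) y` have absolute value `> 19/100` (each written as
"`> 19/100` or `< −19/100`"). -/
theorem two_basal_steep (x y z : ℝ) (hxyz : x ^ 2 + y ^ 2 + z ^ 2 = 1) (hz : z ^ 2 ≤ 9 / 16) :
    ((19 / 100 < x ∨ x < -(19 / 100)) ∧
        (19 / 100 < x / 2 + Real.sqrt 3 / 2 * y ∨ x / 2 + Real.sqrt 3 / 2 * y < -(19 / 100))) ∨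
      ((19 / 100 < x ∨ x < -(19 / 100)) ∧
        (19 / 100 < x / 2 - Real.sqrt 3 / 2 * y ∨ x / 2 - Real.sqrt 3 / 2 * y < -(19 / 100))) ∨
      ((19 / 100 < x / 2 + Real.sqrt 3 / 2 * y ∨ x / 2 + Real.sqrt 3 / 2 * y < -(19 / 100)) ∧
        (19 / 100 < x / 2 - Real.sqrt 3 / 2 * y ∨ x / 2 - Real.sqrt 3 / 2 * y < -(19 / 100))) := by
  have h3 : Real.sqrt 3 ^ 2 = 3 := Real.sq_sqrt (by norm_num)
  have hxy : 7 / 16 ≤ x ^ 2 + y ^ 2 := by nlinarith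
  set b₂ : ℝ := x / 2 + Real.sqrt 3 / 2 * y with hb₂
  set b₃ : ℝ := x / 2 - Real.sqrt 3 / 2 * y with hb₃
  have e1 : b₂ + b₃ = x := by rw [hb₂, hb₃]; ring
  have e2 : (b₂ - b₃) ^ 2 = 3 * y ^ 2 := by rw [hb₂, hb₃]; nlinarith [h3]
  -- "small" means `|t| ≤ 19/100`; at most one of the three is small
  by_cases h1 : 19 / 100 < x ∨ x < -(19 / 100)
  · by_cases h2 : 19 / 100 < b₂ ∨ b₂ < -(19 / 100)
    · exact Or.inl ⟨h1, h2⟩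
    · by_cases h3' : 19 / 100 < b₃ ∨ b₃ < -(19 / 100)
      · exact Or.inr (Or.inl ⟨h1, h3'⟩)
      · exfalso
        push Not at h2 h3'
        nlinarith [h2.1, h2.2, h3'.1, h3'.2]
  · push Not at h1
    by_cases h2 : 19 / 100 < b₂ ∨ b₂ < -(19 / 100)
    · by_cases h3' : 19 / 100 < b₃ ∨ b₃ < -(19 / 100)
      · exact Or.inr (Or.inr ⟨h2, h3'⟩)
      · exfalso
        push Not at h3'
        -- `x` and `b₃` small ⇒ `b₂ = x − b₃` small-ish, `y` small
        have hb2 : b₂ = x - b₃ := by linarith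
        nlinarith [h1.1, h1.2, h3'.1, h3'.2]
    · exfalso
      push Not at h2
      have hb3 : b₃ = x - b₂ := by linarith
      nlinarith [h1.1, h1.2, h2.1, h2.2]

/-- **Orientation cases.**  For every unit direction `(x, y, z)`: (I) all chain slopes `> 19/100`;
or (IV) all chain slopes `< −19/100`; or (II) two steep in-layer families and, for each letter,
an offset with chain slope `> 19/100`; or (III) two steep in-layer families and, for each letter,
an offset with chain slope `< −19/100`. -/
theorem orientation_cases (x y z : ℝ) (hxyz : x ^ 2 + y ^ 2 + z ^ 2 = 1) :
    (∀ s : ℤ, s = 1 ∨ s = -1 → ∀ PQ ∈ threeOffsets (-s),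
        19 / 100 < -(PQ.1 : ℝ) * x - (PQ.2 : ℝ) * (x / 2 + Real.sqrt 3 / 2 * y) +
          (s : ℝ) * (x / 2 + Real.sqrt 3 / 6 * y) + Real.sqrt (2 / 3) * z) ∨
    (∀ s : ℤ, s = 1 ∨ s = -1 → ∀ PQ ∈ threeOffsets (-s),
        -(PQ.1 : ℝ) * x - (PQ.2 : ℝ) * (x / 2 + Real.sqrt 3 / 2 * y) +
          (s : ℝ) * (x / 2 + Real.sqrt 3 / 6 * y) + Real.sqrt (2 / 3) * z < -(19 / 100)) ∨
    ((((19 / 100 < x ∨ x < -(19 / 100)) ∧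
        (19 / 100 < x / 2 + Real.sqrt 3 / 2 * y ∨ x / 2 + Real.sqrt 3 / 2 * y < -(19 / 100))) ∨
      ((19 / 100 < x ∨ x < -(19 / 100)) ∧
        (19 / 100 < x / 2 - Real.sqrt 3 / 2 * y ∨ x / 2 - Real.sqrt 3 / 2 * y < -(19 / 100))) ∨
      ((19 / 100 < x / 2 + Real.sqrt 3 / 2 * y ∨ x / 2 + Real.sqrt 3 / 2 * y < -(19 / 100)) ∧
        (19 / 100 < x / 2 - Real.sqrt 3 / 2 * y ∨ x / 2 - Real.sqrt 3 / 2 * y < -(19 / 100)))) ∧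
      (∀ s : ℤ, s = 1 ∨ s = -1 → ∃ PQ ∈ threeOffsets (-s),
        19 / 100 < -(PQ.1 : ℝ) * x - (PQ.2 : ℝ) * (x / 2 + Real.sqrt 3 / 2 * y) +
          (s : ℝ) * (x / 2 + Real.sqrt 3 / 6 * y) + Real.sqrt (2 / 3) * z)) ∨
    ((((19 / 100 < x ∨ x < -(19 / 100)) ∧
        (19 / 100 < x / 2 + Real.sqrt 3 / 2 * y ∨ x / 2 + Real.sqrt 3 / 2 * y < -(19 / 100))) ∨
      ((19 / 100 < x ∨ x < -(19 / 100)) ∧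
        (19 / 100 < x / 2 - Real.sqrt 3 / 2 * y ∨ x / 2 - Real.sqrt 3 / 2 * y < -(19 / 100))) ∨
      ((19 / 100 < x / 2 + Real.sqrt 3 / 2 * y ∨ x / 2 + Real.sqrt 3 / 2 * y < -(19 / 100)) ∧
        (19 / 100 < x / 2 - Real.sqrt 3 / 2 * y ∨ x / 2 - Real.sqrt 3 / 2 * y < -(19 / 100)))) ∧
      (∀ s : ℤ, s = 1 ∨ s = -1 → ∃ PQ ∈ threeOffsets (-s),
        -(PQ.1 : ℝ) * x - (PQ.2 : ℝ) * (x / 2 + Real.sqrt 3 / 2 * y) +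
          (s : ℝ) * (x / 2 + Real.sqrt 3 / 6 * y) + Real.sqrt (2 / 3) * z < -(19 / 100))) := by
  have hxyz' : (-x) ^ 2 + (-y) ^ 2 + (-z) ^ 2 = 1 := by nlinarith
  by_cases hI : 3 / 4 ≤ z
  · exact Or.inl fun s hs PQ hPQ => chainSlope_gt_of_z_ge x y z hxyz hI hs hPQ
  by_cases hIV : z ≤ -(3 / 4)
  · refine Or.inr (Or.inl fun s hs PQ hPQ => ?_)
    have := chainSlope_gt_of_z_ge (-x) (-y) (-z) hxyz' (by linarith) hs hPQ
    linarith
  have hz2 : z ^ 2 ≤ 9 / 16 := by nlinarith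
  have hB := two_basal_steep x y z hxyz hz2
  by_cases hII : -(1 / 20) ≤ z
  · exact Or.inr (Or.inr (Or.inl ⟨hB, fun s hs => exists_chainSlope_gt_of_z_ge x y z hxyz hII hs⟩))
  · refine Or.inr (Or.inr (Or.inr ⟨hB, fun s hs => ?_⟩))
    obtain ⟨PQ, hPQ, hgt⟩ := exists_chainSlope_gt_of_z_ge (-x) (-y) (-z) hxyz' (by linarith) hs
    exact ⟨PQ, hPQ, by linarith⟩

end Summit.Ventures.Crystal3D.Theorems

end
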